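import Literature.Topology.FourManifolds.CircleFamilyCoordinates
import Mathlib.Analysis.InnerProductSpace.PiL2
import Mathlib.Geometry.Manifold.MFDeriv.Atlas
import Mathlib.Geometry.Manifold.ContMDiffMFDeriv
import HarnessLib

/-!
# Families of maps `ℝ × M → N`: affine perturbation in charts with `m + 1` columns, lifts to
# coordinates, and the stage differential

Topic `Literature/Topology/FourManifolds`; infrastructure for the general-position half of the
tree's proof of Whitney's theorem *homotopic smooth embeddings `Mᵐ → Nⁿ` of a compact manifold
are smoothly isotopic when `n ≥ 2m + 2`* (Whitney (1936), §II Thm. 6, §§8–9; Milnor (1965),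
Thm. 8.4 and Remark; facts of `HomotopicEmbeddingsIsotopic.lean`).  This is the general-`M`
analogue of `CircleFamilies.lean` (§ Perturb) and `CircleFamilyCoordinates.lean`, with the global
lift `θ ↦ circlePoint θ` of the circle replaced by the inverse of an extended chart `φ` of `M`:

* `Literature.Topology.FourManifolds.linCol c`, `affCol c` — the linear map
  `w ↦ ∑ᵢ wᵢ • cᵢ` and the affine map `y ↦ c_last + ∑ᵢ yᵢ • cᵢ` of `ℝᵐ` into `ℝⁿ` with columns
  `c : Fin (m + 1) → ℝⁿ` (the parameters of the generic perturbation), with norm bounds;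
* `Literature.Topology.FourManifolds.boxPerturb G x ρ φ c` — the family `G` moved, in the
  extended chart `ψ` at `x : N`, to `ψ⁻¹ (ψ G + ρ • affCol c ∘ φ)` where `ρ ≠ 0`; basic lemmas
  and smoothness (`contMDiff_boxPerturb`);
* `Literature.Topology.FourManifolds.stageLift m n G u₀ x (t, y) = ψ (G (t, φ⁻¹ y))` (`φ` the
  extended chart of `M` at `u₀`) on its open domain `stageLiftDom m n G u₀ x`: smoothness, smoothness of
  its derivative, and the **bridge** `injective_mfderiv_stage_iff`: the stage `G (t, ·)` has
  injective differential at `φ⁻¹ y` iff `w ↦ D(stageLift) (t, y) (0, w)` is injective;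
* `Literature.Topology.FourManifolds.fderiv_smul_affCol_apply` — the `y`-derivative of the
  perturbation term `ρ̃ • affCol c (·)`: `(∂_w ρ̃) • affCol c y + ρ̃ • linCol c w`, i.e.
  `∑ᵢ aᵢ • cᵢ` with coefficients `a (castSucc i) = ∂_w ρ̃ · yᵢ + ρ̃ · wᵢ`, `a last = ∂_w ρ̃`
  (`sum_stageCoef_smul_eq`), the affine dependence on `c` on which `NullImagesSum.lean`
  operates; `Literature.Topology.FourManifolds.pairCoef` — the coefficients of the two-point
  condition `ρ • affCol c y - ρ' • affCol c y' = ∑ᵢ aᵢ • cᵢ` (`sum_pairCoef_smul_eq`).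

Everything here is proved; the definitions are plain (non-`Prop`) functions and sets.

## References

* H. Whitney, *Differentiable manifolds*, Ann. of Math. (2) 37 (1936), 645–680, §§8–9.
  [Whitney1936]
* J. Milnor, *Lectures on the h-cobordism theorem* (1965), Thm. 8.4 and Remark (PDF p. 56).
  [MilnorHCobordism1965]
* M. W. Hirsch, *Differential Topology*, GTM 33 (1976), Ch. 3 §2 (Thm. 2.5). [HirschDT1976]
-/

open scoped Manifold ContDiff Topology
open Function Set Filter

noncomputable section

namespace Literature.Topology.FourManifolds

variable {m n : ℕ}

/-! ### Affine terms with `m + 1` columns -/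

section Columns

/-- The **linear part** `w ↦ ∑ᵢ wᵢ • c (castSucc i)` of the affine term with columns `c`, as a
continuous linear map `ℝᵐ →L ℝⁿ`. [folklore] -/
def linCol (c : Fin (m + 1) → EuclideanSpace ℝ (Fin n)) :
    EuclideanSpace ℝ (Fin m) →L[ℝ] EuclideanSpace ℝ (Fin n) :=
  ∑ i : Fin m, (EuclideanSpace.proj i).smulRight (c (Fin.castSucc i))

/-- Unfolding of the linear part. [folklore] -/
theorem linCol_apply (c : Fin (m + 1) → EuclideanSpace ℝ (Fin n)) (w : EuclideanSpace ℝ (Fin m)) :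
    linCol c w = ∑ i : Fin m, (EuclideanSpace.proj i w) • c (Fin.castSucc i) := by
  simp [linCol]

/-- The **affine term** `y ↦ c last + ∑ᵢ yᵢ • c (castSucc i)` with columns `c` (Whitney (1936),
§8: modification of a map in a coordinate system by polynomial terms of degree `≤ 1`).
[folklore] -/
def affCol (c : Fin (m + 1) → EuclideanSpace ℝ (Fin n)) (y : EuclideanSpace ℝ (Fin m)) :
    EuclideanSpace ℝ (Fin n) :=
  c (Fin.last m) + linCol c y

/-- Unfolding of the affine term. [folklore] -/
theorem affCol_apply (c : Fin (m + 1) → EuclideanSpace ℝ (Fin n)) (y : EuclideanSpace ℝ (Fin m)) :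
    affCol c y = c (Fin.last m) + ∑ i : Fin m, (EuclideanSpace.proj i y) • c (Fin.castSucc i) := by
  rw [affCol, linCol_apply]

/-- With zero columns the affine term vanishes. [folklore] -/
@[simp] theorem affCol_zero (y : EuclideanSpace ℝ (Fin m)) :
    affCol (0 : Fin (m + 1) → EuclideanSpace ℝ (Fin n)) y = 0 := by
  simp [affCol_apply]

/-- The affine term has derivative the linear part. [folklore] -/
theorem hasFDerivAt_affCol (c : Fin (m + 1) → EuclideanSpace ℝ (Fin n))
    (y : EuclideanSpace ℝ (Fin m)) : HasFDerivAt (affCol c) (linCol c) y :=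
  ((linCol c).hasFDerivAt).const_add (c (Fin.last m))

/-- The affine term is smooth. [folklore] -/
theorem contDiff_affCol (c : Fin (m + 1) → EuclideanSpace ℝ (Fin n)) : ContDiff ℝ ∞ (affCol c) :=
  contDiff_const.add (linCol c).contDiff

/-- **Norm bound for the linear part**: `‖linCol c w‖ ≤ m ‖c‖ ‖w‖`. [folklore] -/
theorem norm_linCol_le (c : Fin (m + 1) → EuclideanSpace ℝ (Fin n)) (w : EuclideanSpace ℝ (Fin m)) :
    ‖linCol c w‖ ≤ m * ‖c‖ * ‖w‖ := by
  rw [linCol_apply]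
  calc ‖∑ i : Fin m, (EuclideanSpace.proj i w) • c (Fin.castSucc i)‖
      ≤ ∑ i : Fin m, ‖(EuclideanSpace.proj i w) • c (Fin.castSucc i)‖ := norm_sum_le _ _
    _ ≤ ∑ _i : Fin m, ‖w‖ * ‖c‖ := by
        refine Finset.sum_le_sum fun i _ => ?_
        rw [norm_smul]
        refine mul_le_mul ?_ (norm_le_pi_norm c _) (norm_nonneg _) (norm_nonneg _)
        simpa using PiLp.norm_apply_le w i
    _ = m * ‖c‖ * ‖w‖ := by
        rw [Finset.sum_const, Finset.card_univ, Fintype.card_fin, nsmul_eq_mul]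
        ring

/-- **Norm bound for the affine term**: `‖affCol c y‖ ≤ (1 + m ‖y‖) ‖c‖`. [folklore] -/
theorem norm_affCol_le (c : Fin (m + 1) → EuclideanSpace ℝ (Fin n)) (y : EuclideanSpace ℝ (Fin m)) :
    ‖affCol c y‖ ≤ (1 + m * ‖y‖) * ‖c‖ := by
  rw [affCol]
  calc ‖c (Fin.last m) + linCol c y‖ ≤ ‖c (Fin.last m)‖ + ‖linCol c y‖ := norm_add_le _ _
    _ ≤ ‖c‖ + m * ‖c‖ * ‖y‖ := add_le_add (norm_le_pi_norm c _) (norm_linCol_le c y)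
    _ = (1 + m * ‖y‖) * ‖c‖ := by ring

end Columns

/-! ### Coefficients of the derivative of the perturbation term -/

section Coefficients

/-- The **coefficient vector** of the `y`-derivative of `ρ̃ • affCol c (·)`: with `d = ∂_w ρ̃`,
`s = ρ̃`: `a (castSucc i) = d yᵢ + s wᵢ`, `a last = d`. [folklore] -/
def stageCoef (d s : ℝ) (y w : EuclideanSpace ℝ (Fin m)) : Fin (m + 1) → ℝ :=
  Fin.snoc (fun i => d * EuclideanSpace.proj i y + s * EuclideanSpace.proj i w) d

/-- The last coefficient is `d`. [folklore] -/
@[simp] theorem stageCoef_last (d s : ℝ) (y w : EuclideanSpace ℝ (Fin m)) :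
    stageCoef d s y w (Fin.last m) = d := by
  simp [stageCoef]

/-- The other coefficients. [folklore] -/
@[simp] theorem stageCoef_castSucc (d s : ℝ) (y w : EuclideanSpace ℝ (Fin m)) (i : Fin m) :
    stageCoef d s y w (Fin.castSucc i) = d * EuclideanSpace.proj i y + s * EuclideanSpace.proj i w := by
  simp [stageCoef]

/-- **The derivative of the perturbation term is `∑ᵢ aᵢ • cᵢ`**:
`d • affCol c y + s • linCol c w = ∑ᵢ stageCoef d s y w i • c i`. [folklore] -/
theorem sum_stageCoef_smul_eq (d s : ℝ) (y w : EuclideanSpace ℝ (Fin m))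
    (c : Fin (m + 1) → EuclideanSpace ℝ (Fin n)) :
    ∑ i, stageCoef d s y w i • c i = d • affCol c y + s • linCol c w := by
  rw [Fin.sum_univ_castSucc, affCol_apply, linCol_apply]
  simp only [stageCoef_castSucc, stageCoef_last, smul_add, Finset.smul_sum, smul_smul, add_smul,
    Finset.sum_add_distrib]
  abel

/-- The coefficient vector vanishes iff `d = 0` and `s • w = 0`. [folklore] -/
theorem stageCoef_eq_zero_iff (d s : ℝ) (y w : EuclideanSpace ℝ (Fin m)) :
    stageCoef d s y w = 0 ↔ d = 0 ∧ s • w = 0 := by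
  constructor
  · intro h
    have hd : d = 0 := by simpa using congrFun h (Fin.last m)
    refine ⟨hd, ?_⟩
    ext i
    have := congrFun h (Fin.castSucc i)
    rw [stageCoef_castSucc, hd, zero_mul, zero_add] at this
    simpa using this
  · rintro ⟨hd, hsw⟩
    funext i
    refine Fin.lastCases ?_ (fun i => ?_) i
    · simp [hd]
    · rw [stageCoef_castSucc, hd, zero_mul, zero_add]
      have := congrArg (EuclideanSpace.proj i) hsw
      simpa using this

end Coefficients

/-! ### Coefficients of the two-point condition -/

section PairCoef

/-- The **coefficient vector of the two-point condition**: for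
`ρ • affCol c y - ρ' • affCol c y' = ∑ᵢ aᵢ • cᵢ`: `a (castSucc i) = ρ yᵢ - ρ' y'ᵢ`,
`a last = ρ - ρ'`. [folklore] -/
def pairCoef (ρ ρ' : ℝ) (y y' : EuclideanSpace ℝ (Fin m)) : Fin (m + 1) → ℝ :=
  Fin.snoc (fun i => ρ * EuclideanSpace.proj i y - ρ' * EuclideanSpace.proj i y') (ρ - ρ')

/-- The last coefficient. [folklore] -/
@[simp] theorem pairCoef_last (ρ ρ' : ℝ) (y y' : EuclideanSpace ℝ (Fin m)) :
    pairCoef ρ ρ' y y' (Fin.last m) = ρ - ρ' := by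
  simp [pairCoef]

/-- The other coefficients. [folklore] -/
@[simp] theorem pairCoef_castSucc (ρ ρ' : ℝ) (y y' : EuclideanSpace ℝ (Fin m)) (i : Fin m) :
    pairCoef ρ ρ' y y' (Fin.castSucc i) =
      ρ * EuclideanSpace.proj i y - ρ' * EuclideanSpace.proj i y' := by
  simp [pairCoef]

/-- **The two-point identity**: `∑ᵢ pairCoef ρ ρ' y y' i • cᵢ = ρ • affCol c y - ρ' • affCol c y'`.
[folklore] -/
theorem sum_pairCoef_smul_eq (ρ ρ' : ℝ) (y y' : EuclideanSpace ℝ (Fin m))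
    (c : Fin (m + 1) → EuclideanSpace ℝ (Fin n)) :
    ∑ i, pairCoef ρ ρ' y y' i • c i = ρ • affCol c y - ρ' • affCol c y' := by
  rw [Fin.sum_univ_castSucc, affCol_apply, affCol_apply]
  simp only [pairCoef_castSucc, pairCoef_last, smul_add, Finset.smul_sum, smul_smul, sub_smul,
    Finset.sum_sub_distrib]
  abel

/-- If all two-point coefficients vanish then `ρ = ρ'` and `ρ • y = ρ' • y'`. [folklore] -/
theorem eq_of_pairCoef_eq_zero {ρ ρ' : ℝ} {y y' : EuclideanSpace ℝ (Fin m)}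
    (h : ∀ j, pairCoef ρ ρ' y y' j = 0) : ρ = ρ' ∧ ρ • y = ρ' • y' := by
  have hlast : ρ = ρ' := by simpa [sub_eq_zero] using h (Fin.last m)
  refine ⟨hlast, ?_⟩
  ext i
  have := h (Fin.castSucc i)
  rw [pairCoef_castSucc, sub_eq_zero] at this
  simpa using this

end PairCoef

/-! ### Perturbation of a family inside charts -/

section Perturb

variable {M : Type*} {N : Type*} [TopologicalSpace N] [ChartedSpace (EuclideanSpace ℝ (Fin n)) N]

open Classical in
/-- **Perturbation of the family `G` inside the extended chart at `x`** by the affine term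
`ρ p • affCol c (φ p.2)`, `c : Fin (m + 1) → ℝⁿ` the columns, `φ : M → ℝᵐ` a coordinate map of
`M` (an extended chart, as a function): where `ρ p ≠ 0` the point `G p` is moved, in the
coordinates of the extended chart `ψ` at `x`, to `ψ⁻¹ (ψ (G p) + ρ p • affCol c (φ p.2))`; where
`ρ p = 0` it is left alone (Whitney (1936), §8; the circle case is `chartPerturb`,
`CircleFamilies.lean`). [folklore] -/
def boxPerturb (G : ℝ × M → N) (x : N) (ρ : ℝ × M → ℝ) (φ : M → EuclideanSpace ℝ (Fin m))
    (c : Fin (m + 1) → EuclideanSpace ℝ (Fin n)) (p : ℝ × M) : N :=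
  if ρ p = 0 then G p
  else (extChartAt (𝓡 n) x).symm (extChartAt (𝓡 n) x (G p) + ρ p • affCol c (φ p.2))

variable {G : ℝ × M → N} {x : N} {ρ : ℝ × M → ℝ} {φ : M → EuclideanSpace ℝ (Fin m)}
  {c : Fin (m + 1) → EuclideanSpace ℝ (Fin n)}

/-- Where the bump vanishes the perturbation does nothing. [folklore] -/
theorem boxPerturb_of_eq_zero {p : ℝ × M} (h : ρ p = 0) : boxPerturb G x ρ φ c p = G p := by
  simp [boxPerturb, h]

/-- On the chart source the perturbation is given by the chart formula (also where `ρ p = 0`).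
[folklore] -/
theorem boxPerturb_eq_of_mem_source {p : ℝ × M}
    (h : G p ∈ (chartAt (EuclideanSpace ℝ (Fin n)) x).source) :
    boxPerturb G x ρ φ c p =
      (extChartAt (𝓡 n) x).symm (extChartAt (𝓡 n) x (G p) + ρ p • affCol c (φ p.2)) := by
  by_cases hρ : ρ p = 0
  · rw [boxPerturb_of_eq_zero hρ, hρ, zero_smul, add_zero]
    exact ((extChartAt (𝓡 n) x).left_inv (by rwa [extChartAt_source])).symm
  · simp [boxPerturb, hρ]

/-- With zero columns the perturbation does nothing. [folklore] -/
theorem boxPerturb_zero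
    (hsrc : ∀ p, ρ p ≠ 0 → G p ∈ (chartAt (EuclideanSpace ℝ (Fin n)) x).source) :
    boxPerturb G x ρ φ (0 : Fin (m + 1) → EuclideanSpace ℝ (Fin n)) = G := by
  funext p
  by_cases hρ : ρ p = 0
  · exact boxPerturb_of_eq_zero hρ
  · rw [boxPerturb_eq_of_mem_source (hsrc p hρ), affCol_zero, smul_zero, add_zero]
    exact (extChartAt (𝓡 n) x).left_inv (by rw [extChartAt_source]; exact hsrc p hρ)

/-- At a point of the chart source whose perturbed coordinates stay in the chart target, the
perturbed point lies in the chart source and has the expected coordinates. [folklore] -/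
theorem boxPerturb_mem_source {p : ℝ × M}
    (h : G p ∈ (chartAt (EuclideanSpace ℝ (Fin n)) x).source)
    (ht : extChartAt (𝓡 n) x (G p) + ρ p • affCol c (φ p.2) ∈ (extChartAt (𝓡 n) x).target) :
    boxPerturb G x ρ φ c p ∈ (chartAt (EuclideanSpace ℝ (Fin n)) x).source ∧
      extChartAt (𝓡 n) x (boxPerturb G x ρ φ c p) =
        extChartAt (𝓡 n) x (G p) + ρ p • affCol c (φ p.2) := by
  rw [boxPerturb_eq_of_mem_source h]
  refine ⟨?_, (extChartAt (𝓡 n) x).right_inv ht⟩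
  rw [← extChartAt_source (𝓡 n)]
  exact (extChartAt (𝓡 n) x).map_target ht

variable [TopologicalSpace M]

/-- Off the topological support of the bump the perturbed family agrees with `G` near the point.
[folklore] -/
theorem boxPerturb_eventuallyEq {p : ℝ × M} (hp : p ∉ tsupport ρ) :
    boxPerturb G x ρ φ c =ᶠ[𝓝 p] G := by
  filter_upwards [notMem_tsupport_iff_eventuallyEq.1 hp] with p' hp'
  exact boxPerturb_of_eq_zero hp'

variable [ChartedSpace (EuclideanSpace ℝ (Fin m)) M] [IsManifold (𝓡 m) ∞ M] [IsManifold (𝓡 n) ∞ N]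

/-- **Smoothness of the perturbed family.**  If `G`, `ρ` are smooth, `R ⊇ tsupport ρ` is an open
set lying over the source of the chart of `M` at `u₀` and mapped by `G` into the source of the
chart at `x`, and the perturbed coordinates of the points of `R` stay in the chart target, then
`boxPerturb G x ρ (extChartAt u₀) c` is smooth: on `R` it is the chart formula, off `tsupport ρ`
it is `G`. [folklore] -/
theorem contMDiff_boxPerturb (hG : ContMDiff (𝓘(ℝ, ℝ).prod (𝓡 m)) (𝓡 n) ∞ G)
    (hρ : ContMDiff (𝓘(ℝ, ℝ).prod (𝓡 m)) 𝓘(ℝ, ℝ) ∞ ρ) {u₀ : M} {R : Set (ℝ × M)} (hR : IsOpen R)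
    (hsupp : tsupport ρ ⊆ R)
    (hRM : R ⊆ (univ : Set ℝ) ×ˢ (chartAt (EuclideanSpace ℝ (Fin m)) u₀).source)
    (hsrc : MapsTo G R (chartAt (EuclideanSpace ℝ (Fin n)) x).source)
    (htgt : ∀ p ∈ R, extChartAt (𝓡 n) x (G p) + ρ p • affCol c (extChartAt (𝓡 m) u₀ p.2) ∈
      (extChartAt (𝓡 n) x).target) :
    ContMDiff (𝓘(ℝ, ℝ).prod (𝓡 m)) (𝓡 n) ∞ (boxPerturb G x ρ (extChartAt (𝓡 m) u₀) c) := by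
  set F : ℝ × M → N := fun p => (extChartAt (𝓡 n) x).symm
    (extChartAt (𝓡 n) x (G p) + ρ p • affCol c (extChartAt (𝓡 m) u₀ p.2)) with hF
  have hφ : ContMDiffOn (𝓘(ℝ, ℝ).prod (𝓡 m)) 𝓘(ℝ, EuclideanSpace ℝ (Fin m)) ∞
      (fun p : ℝ × M => extChartAt (𝓡 m) u₀ p.2) R :=
    contMDiffOn_extChartAt.comp contMDiff_snd.contMDiffOn fun p hp => (hRM hp).2
  have hinner : ContMDiffOn (𝓘(ℝ, ℝ).prod (𝓡 m)) 𝓘(ℝ, EuclideanSpace ℝ (Fin n)) ∞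
      (fun p : ℝ × M => extChartAt (𝓡 n) x (G p) +
        ρ p • affCol c (extChartAt (𝓡 m) u₀ p.2)) R := by
    have h1 : ContMDiffOn (𝓘(ℝ, ℝ).prod (𝓡 m)) 𝓘(ℝ, EuclideanSpace ℝ (Fin n)) ∞
        (fun p : ℝ × M => extChartAt (𝓡 n) x (G p)) R :=
      contMDiffOn_extChartAt.comp hG.contMDiffOn hsrc
    have h2 : ContMDiffOn (𝓘(ℝ, ℝ).prod (𝓡 m)) 𝓘(ℝ, EuclideanSpace ℝ (Fin n)) ∞
        (fun p : ℝ × M => affCol c (extChartAt (𝓡 m) u₀ p.2)) R :=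
      (contDiff_affCol c).contMDiff.comp_contMDiffOn hφ
    exact h1.add (hρ.contMDiffOn.smul h2)
  have hFR : ContMDiffOn (𝓘(ℝ, ℝ).prod (𝓡 m)) (𝓡 n) ∞ F R :=
    (contMDiffOn_extChartAt_symm x).comp hinner htgt
  intro p
  by_cases hp : p ∈ R
  · have heq : boxPerturb G x ρ (extChartAt (𝓡 m) u₀) c =ᶠ[𝓝 p] F := by
      filter_upwards [hR.mem_nhds hp] with p' hp'
      exact boxPerturb_eq_of_mem_source (hsrc hp')
    exact (hFR.contMDiffAt (hR.mem_nhds hp)).congr_of_eventuallyEq heq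
  · have hp' : p ∉ tsupport ρ := fun h => hp (hsupp h)
    exact (hG p).congr_of_eventuallyEq (boxPerturb_eventuallyEq hp')

end Perturb

/-! ### Lifts to coordinates `(t, y)`, `y` in the chart target of `M` -/

section Lift

variable {M : Type*} [TopologicalSpace M] [ChartedSpace (EuclideanSpace ℝ (Fin m)) M]
  {N : Type*} [TopologicalSpace N] [ChartedSpace (EuclideanSpace ℝ (Fin n)) N]

variable (m n) in
/-- The **domain of the lift** of `G` through the charts at `u₀ : M` and `x : N`:
`{(t, y) | y ∈ φ.target, G (t, φ⁻¹ y) ∈ chart source at x}` (the dimensions `m`, `n` are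
explicit arguments). [folklore] -/
def stageLiftDom (G : ℝ × M → N) (u₀ : M) (x : N) : Set (ℝ × EuclideanSpace ℝ (Fin m)) :=
  {z | z.2 ∈ (extChartAt (𝓡 m) u₀).target ∧
    G (z.1, (extChartAt (𝓡 m) u₀).symm z.2) ∈ (chartAt (EuclideanSpace ℝ (Fin n)) x).source}

variable (m n) in
/-- The **lift of `G` to coordinates**: `(t, y) ↦ ψ (G (t, φ⁻¹ y))`, `φ`, `ψ` the extended charts
at `u₀ : M`, `x : N` (the dimensions `m`, `n` are explicit arguments). [folklore] -/
def stageLift (G : ℝ × M → N) (u₀ : M) (x : N) (z : ℝ × EuclideanSpace ℝ (Fin m)) :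
    EuclideanSpace ℝ (Fin n) :=
  extChartAt (𝓡 n) x (G (z.1, (extChartAt (𝓡 m) u₀).symm z.2))

variable {G : ℝ × M → N} {u₀ : M} {x : N}

/-- Membership in the lift domain. [folklore] -/
theorem mem_stageLiftDom {z : ℝ × EuclideanSpace ℝ (Fin m)} :
    z ∈ stageLiftDom m n G u₀ x ↔ z.2 ∈ (extChartAt (𝓡 m) u₀).target ∧
      G (z.1, (extChartAt (𝓡 m) u₀).symm z.2) ∈ (chartAt (EuclideanSpace ℝ (Fin n)) x).source :=
  Iff.rfl

/-- Unfolding of the lift. [folklore] -/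
theorem stageLift_apply (z : ℝ × EuclideanSpace ℝ (Fin m)) :
    stageLift m n G u₀ x z = extChartAt (𝓡 n) x (G (z.1, (extChartAt (𝓡 m) u₀).symm z.2)) := rfl

/-- The map `(t, y) ↦ (t, φ⁻¹ y)` is continuous on `ℝ × φ.target`. [folklore] -/
theorem continuousOn_prod_extChartAt_symm (u₀ : M) :
    ContinuousOn (fun z : ℝ × EuclideanSpace ℝ (Fin m) => ((z.1, (extChartAt (𝓡 m) u₀).symm z.2) : ℝ × M))
      ((univ : Set ℝ) ×ˢ (extChartAt (𝓡 m) u₀).target) :=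
  continuousOn_fst.prodMk ((continuousOn_extChartAt_symm u₀).comp continuousOn_snd
    fun _ hz => hz.2)

/-- **The lift domain is open**, for continuous `G`. [folklore] -/
theorem isOpen_stageLiftDom (hG : Continuous G) (u₀ : M) (x : N) : IsOpen (stageLiftDom m n G u₀ x) := by
  have h := ((continuousOn_prod_extChartAt_symm (m := m) u₀)).isOpen_inter_preimage
    (s := (univ : Set ℝ) ×ˢ (extChartAt (𝓡 m) u₀).target)
    (isOpen_univ.prod (isOpen_extChartAt_target u₀))
    ((chartAt (EuclideanSpace ℝ (Fin n)) x).open_source.preimage hG)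
  convert h using 1
  ext z
  simp [stageLiftDom, mem_preimage]

variable [IsManifold (𝓡 m) ∞ M] [IsManifold (𝓡 n) ∞ N]

/-- The map `(t, y) ↦ (t, φ⁻¹ y)` is smooth on `ℝ × φ.target`. [folklore] -/
theorem contMDiffOn_prod_extChartAt_symm (u₀ : M) :
    ContMDiffOn (𝓘(ℝ, ℝ).prod 𝓘(ℝ, EuclideanSpace ℝ (Fin m))) (𝓘(ℝ, ℝ).prod (𝓡 m)) ∞
      (fun z : ℝ × EuclideanSpace ℝ (Fin m) => ((z.1, (extChartAt (𝓡 m) u₀).symm z.2) : ℝ × M))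
      ((univ : Set ℝ) ×ˢ (extChartAt (𝓡 m) u₀).target) :=
  contMDiffOn_fst.prodMk ((contMDiffOn_extChartAt_symm u₀).comp contMDiffOn_snd
    fun _ hz => hz.2)

/-- **The lift is smooth** on its domain (in the vector-space sense). [folklore] -/
theorem contDiffOn_stageLift (hG : ContMDiff (𝓘(ℝ, ℝ).prod (𝓡 m)) (𝓡 n) ∞ G) (u₀ : M) (x : N) :
    ContDiffOn ℝ ∞ (stageLift m n G u₀ x) (stageLiftDom m n G u₀ x) := by
  apply contDiffOn_of_contMDiffOn_prod_self
  have h1 : ContMDiffOn (𝓘(ℝ, ℝ).prod 𝓘(ℝ, EuclideanSpace ℝ (Fin m))) (𝓡 n) ∞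
      (fun z : ℝ × EuclideanSpace ℝ (Fin m) => G (z.1, (extChartAt (𝓡 m) u₀).symm z.2))
      (stageLiftDom m n G u₀ x) :=
    hG.comp_contMDiffOn ((contMDiffOn_prod_extChartAt_symm u₀).mono fun z hz => ⟨mem_univ _, hz.1⟩)
  exact contMDiffOn_extChartAt.comp h1 fun z hz => hz.2

/-- The lift is differentiable at every point of its domain. [folklore] -/
theorem differentiableAt_stageLift (hG : ContMDiff (𝓘(ℝ, ℝ).prod (𝓡 m)) (𝓡 n) ∞ G) {u₀ : M} {x : N}
    {z : ℝ × EuclideanSpace ℝ (Fin m)} (hz : z ∈ stageLiftDom m n G u₀ x) :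
    DifferentiableAt ℝ (stageLift m n G u₀ x) z :=
  ((contDiffOn_stageLift hG u₀ x).differentiableOn (by simp)).differentiableAt
    ((isOpen_stageLiftDom hG.continuous u₀ x).mem_nhds hz)

/-- **The derivative of the lift is smooth** on the domain. [folklore] -/
theorem contDiffOn_fderiv_stageLift (hG : ContMDiff (𝓘(ℝ, ℝ).prod (𝓡 m)) (𝓡 n) ∞ G) (u₀ : M)
    (x : N) : ContDiffOn ℝ ∞ (fun z => fderiv ℝ (stageLift m n G u₀ x) z) (stageLiftDom m n G u₀ x) :=
  (contDiffOn_stageLift hG u₀ x).fderiv_of_isOpen (isOpen_stageLiftDom hG.continuous u₀ x) (by simp)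

/-- The directional derivatives `(z, w) ↦ D(stageLift) z (0, w)` are differentiable on
`stageLiftDom × ℝᵐ`. [folklore] -/
theorem differentiableOn_fderiv_stageLift_apply (hG : ContMDiff (𝓘(ℝ, ℝ).prod (𝓡 m)) (𝓡 n) ∞ G)
    (u₀ : M) (x : N) :
    DifferentiableOn ℝ
      (fun q : (ℝ × EuclideanSpace ℝ (Fin m)) × EuclideanSpace ℝ (Fin m) =>
        fderiv ℝ (stageLift m n G u₀ x) q.1 ((0 : ℝ), q.2))
      (stageLiftDom m n G u₀ x ×ˢ (univ : Set (EuclideanSpace ℝ (Fin m)))) := by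
  have h1 : DifferentiableOn ℝ (fun q : (ℝ × EuclideanSpace ℝ (Fin m)) × EuclideanSpace ℝ (Fin m) =>
      fderiv ℝ (stageLift m n G u₀ x) q.1) (stageLiftDom m n G u₀ x ×ˢ univ) :=
    ((contDiffOn_fderiv_stageLift hG u₀ x).differentiableOn (by simp)).comp
      differentiableOn_fst fun q hq => hq.1
  have h2 : Differentiable ℝ (fun q : (ℝ × EuclideanSpace ℝ (Fin m)) × EuclideanSpace ℝ (Fin m) =>
      (((0 : ℝ), q.2) : ℝ × EuclideanSpace ℝ (Fin m))) :=
    (differentiable_const _).prodMk differentiable_snd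
  exact h1.clm_apply h2.differentiableOn

/-- **Slice derivative**: `y ↦ stageLift (t, y)` has derivative `D(stageLift) (t, y) ∘ inr`.
[folklore] -/
theorem hasFDerivAt_stageLift_slice (hG : ContMDiff (𝓘(ℝ, ℝ).prod (𝓡 m)) (𝓡 n) ∞ G)
    {z : ℝ × EuclideanSpace ℝ (Fin m)} (hz : z ∈ stageLiftDom m n G u₀ x) :
    HasFDerivAt (fun y => stageLift m n G u₀ x (z.1, y))
      ((fderiv ℝ (stageLift m n G u₀ x) z).comp
        (ContinuousLinearMap.inr ℝ ℝ (EuclideanSpace ℝ (Fin m)))) z.2 := by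
  have h := (differentiableAt_stageLift hG hz).hasFDerivAt
  exact h.comp z.2 (hasFDerivAt_prodMk_right (𝕜 := ℝ) z.1 z.2)

/-- **Bridge to the lift.**  Let `G` be a smooth family and `z = (t, y)` a point of the lift
domain (charts at `u₀ : M`, `x : N`).  Then the stage `G (t, ·)` has injective differential at
`u = φ⁻¹ y` iff `w ↦ D(stageLift) z (0, w)` is injective: near `u` the stage is
`ψ⁻¹ ∘ stageLift (t, ·) ∘ φ` and the differentials of the charts are invertible. [folklore] -/
theorem injective_mfderiv_stage_iff (hG : ContMDiff (𝓘(ℝ, ℝ).prod (𝓡 m)) (𝓡 n) ∞ G)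
    {z : ℝ × EuclideanSpace ℝ (Fin m)} (hz : z ∈ stageLiftDom m n G u₀ x) :
    Injective (mfderiv (𝓡 m) (𝓡 n) (fun u => G (z.1, u)) ((extChartAt (𝓡 m) u₀).symm z.2)) ↔
      Injective ((fderiv ℝ (stageLift m n G u₀ x) z).comp
        (ContinuousLinearMap.inr ℝ ℝ (EuclideanSpace ℝ (Fin m)))) := by
  set φ := extChartAt (𝓡 m) u₀ with hφ
  set ψ := extChartAt (𝓡 n) x with hψ
  set u : M := φ.symm z.2 with hu
  set f : M → N := fun u => G (z.1, u) with hf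
  set g : EuclideanSpace ℝ (Fin m) → EuclideanSpace ℝ (Fin n) := fun y => stageLift m n G u₀ x (z.1, y)
    with hg
  have huφ : u ∈ φ.source := φ.map_target hz.1
  have huφ' : u ∈ (chartAt (EuclideanSpace ℝ (Fin m)) u₀).source := by
    rwa [← extChartAt_source (I := 𝓡 m)]
  have hφu : φ u = z.2 := φ.right_inv hz.1
  have hfs : ContMDiff (𝓡 m) (𝓡 n) ∞ f := hG.comp (contMDiff_const.prodMk contMDiff_id)
  have hfu : f u ∈ (chartAt (EuclideanSpace ℝ (Fin n)) x).source := hz.2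
  -- the stage near `u` is `ψ⁻¹ ∘ g ∘ φ`
  have hev : f =ᶠ[𝓝 u] (ψ.symm ∘ g ∘ φ) := by
    have hO : IsOpen (φ.source ∩ f ⁻¹' (chartAt (EuclideanSpace ℝ (Fin n)) x).source) := by
      rw [hφ, extChartAt_source]
      exact (chartAt _ u₀).open_source.inter
        ((chartAt (EuclideanSpace ℝ (Fin n)) x).open_source.preimage hfs.continuous)
    filter_upwards [hO.mem_nhds ⟨huφ, hfu⟩] with u' hu'
    change f u' = ψ.symm (ψ (G (z.1, φ.symm (φ u'))))
    rw [φ.left_inv hu'.1]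
    exact (ψ.left_inv (by rw [hψ, extChartAt_source]; exact hu'.2)).symm
  -- differentiability of the three maps
  have hgd : DifferentiableAt ℝ g (φ u) := by
    rw [hφu]
    exact (hasFDerivAt_stageLift_slice hG hz).differentiableAt
  have hgm : MDifferentiableAt 𝓘(ℝ, EuclideanSpace ℝ (Fin m)) 𝓘(ℝ, EuclideanSpace ℝ (Fin n)) g (φ u) :=
    hgd.mdifferentiableAt
  have hφm : MDifferentiableAt (𝓡 m) 𝓘(ℝ, EuclideanSpace ℝ (Fin m)) φ u := mdifferentiableAt_extChartAt huφ'
  have hgφu : g (φ u) ∈ ψ.target := by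
    rw [hφu, hg]
    dsimp only
    rw [stageLift_apply]
    exact ψ.map_source (by rw [hψ, extChartAt_source]; exact hz.2)
  have hrange : range (𝓡 n) = univ := (𝓡 n).range_eq_univ
  have hψm : MDifferentiableAt 𝓘(ℝ, EuclideanSpace ℝ (Fin n)) (𝓡 n) ψ.symm (g (φ u)) := by
    have := mdifferentiableWithinAt_extChartAt_symm hgφu
    rwa [hrange, mdifferentiableWithinAt_univ] at this
  -- the chain rule
  have hcomp : mfderiv (𝓡 m) (𝓡 n) f u =
      (mfderiv 𝓘(ℝ, EuclideanSpace ℝ (Fin n)) (𝓡 n) ψ.symm (g (φ u))).comp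
        ((mfderiv 𝓘(ℝ, EuclideanSpace ℝ (Fin m)) 𝓘(ℝ, EuclideanSpace ℝ (Fin n)) g (φ u)).comp
          (mfderiv (𝓡 m) 𝓘(ℝ, EuclideanSpace ℝ (Fin m)) φ u)) := by
    rw [hev.mfderiv_eq]
    rw [mfderiv_comp u hψm (hgm.comp u hφm), mfderiv_comp u hgm hφm]
    rfl
  -- invertibility of the chart differentials
  have hφinv : (mfderiv (𝓡 m) 𝓘(ℝ, EuclideanSpace ℝ (Fin m)) φ u).IsInvertible :=
    isInvertible_mfderiv_extChartAt huφ
  have hψinv : (mfderiv 𝓘(ℝ, EuclideanSpace ℝ (Fin n)) (𝓡 n) ψ.symm (g (φ u))).IsInvertible := by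
    have := isInvertible_mfderivWithin_extChartAt_symm hgφu
    rwa [hrange, mfderivWithin_univ] at this
  obtain ⟨A, hA⟩ := hψinv
  obtain ⟨B, hB⟩ := hφinv
  -- the derivative of `g` is the slice derivative of the lift
  have hgder : mfderiv 𝓘(ℝ, EuclideanSpace ℝ (Fin m)) 𝓘(ℝ, EuclideanSpace ℝ (Fin n)) g (φ u) =
      (fderiv ℝ (stageLift m n G u₀ x) z).comp
        (ContinuousLinearMap.inr ℝ ℝ (EuclideanSpace ℝ (Fin m))) := by
    rw [mfderiv_eq_fderiv, hφu]
    exact (hasFDerivAt_stageLift_slice hG hz).fderiv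
  rw [hcomp, ← hA, ← hB, hgder]
  set L := (fderiv ℝ (stageLift m n G u₀ x) z).comp
    (ContinuousLinearMap.inr ℝ ℝ (EuclideanSpace ℝ (Fin m))) with hL
  change Injective (fun v => A (L (B v))) ↔ Injective L
  exact (Injective.of_comp_iff A.injective _).trans (Injective.of_comp_iff' _ B.bijective)

end Lift

/-! ### The `y`-derivative of the perturbation term -/

section Affine

/-- **Derivative of the perturbation term.**  For `ρ̃ : ℝ × ℝᵐ → ℝ` differentiable at `z` and
columns `c`:
`D (ρ̃ • affCol c ∘ snd) z (0, w) = (D ρ̃ z (0, w)) • affCol c z.2 + ρ̃ z • linCol c w`.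
[folklore] -/
theorem fderiv_smul_affCol_apply {ρL : ℝ × EuclideanSpace ℝ (Fin m) → ℝ}
    {z : ℝ × EuclideanSpace ℝ (Fin m)} (hρ : DifferentiableAt ℝ ρL z)
    (c : Fin (m + 1) → EuclideanSpace ℝ (Fin n)) (w : EuclideanSpace ℝ (Fin m)) :
    fderiv ℝ (fun z : ℝ × EuclideanSpace ℝ (Fin m) => ρL z • affCol c z.2) z ((0 : ℝ), w) =
      (fderiv ℝ ρL z ((0 : ℝ), w)) • affCol c z.2 + ρL z • linCol c w := by
  have haff : HasFDerivAt (fun z : ℝ × EuclideanSpace ℝ (Fin m) => affCol c z.2)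
      ((linCol c).comp (ContinuousLinearMap.snd ℝ ℝ (EuclideanSpace ℝ (Fin m)))) z :=
    (hasFDerivAt_affCol c z.2).comp z hasFDerivAt_snd
  have h := hρ.hasFDerivAt.smul haff
  rw [show (fun z : ℝ × EuclideanSpace ℝ (Fin m) => ρL z • affCol c z.2) =
      ρL • fun z : ℝ × EuclideanSpace ℝ (Fin m) => affCol c z.2 from rfl, h.fderiv]
  simp only [_root_.add_apply, ContinuousLinearMap.smulRight_apply, FunLike.coe_smul,
    Pi.smul_apply, ContinuousLinearMap.coe_comp, comp_apply, ContinuousLinearMap.coe_snd']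
  rw [add_comm]

/-- The same, written as `∑ᵢ aᵢ • cᵢ` with the coefficient vector `stageCoef`. [folklore] -/
theorem fderiv_smul_affCol_apply_eq_sum {ρL : ℝ × EuclideanSpace ℝ (Fin m) → ℝ}
    {z : ℝ × EuclideanSpace ℝ (Fin m)} (hρ : DifferentiableAt ℝ ρL z)
    (c : Fin (m + 1) → EuclideanSpace ℝ (Fin n)) (w : EuclideanSpace ℝ (Fin m)) :
    fderiv ℝ (fun z : ℝ × EuclideanSpace ℝ (Fin m) => ρL z • affCol c z.2) z ((0 : ℝ), w) =
      ∑ i, stageCoef (fderiv ℝ ρL z ((0 : ℝ), w)) (ρL z) z.2 w i • c i := by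
  rw [fderiv_smul_affCol_apply hρ, sum_stageCoef_smul_eq]

/-- The perturbation term is differentiable where `ρ̃` is. [folklore] -/
theorem differentiableAt_smul_affCol {ρL : ℝ × EuclideanSpace ℝ (Fin m) → ℝ}
    {z : ℝ × EuclideanSpace ℝ (Fin m)} (hρ : DifferentiableAt ℝ ρL z)
    (c : Fin (m + 1) → EuclideanSpace ℝ (Fin n)) :
    DifferentiableAt ℝ (fun z : ℝ × EuclideanSpace ℝ (Fin m) => ρL z • affCol c z.2) z :=
  hρ.smul (((contDiff_affCol c).differentiable (by simp)).differentiableAt.comp z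
    differentiableAt_snd)

end Affine

end Literature.Topology.FourManifolds
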